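import Summits.AtomisticToContinuum.BoseEinsteinCondensation.Theorems.BECInsertionCorrectorBoundaryTransferWeakFreeOneBodyApproxCutoff
import Literature.MathematicalPhysics.QuantumManyBody.BoseEinsteinCondensation
import Literature.Probability.Distributions.GaussianPiDensity
import Mathlib.Analysis.SpecialFunctions.Integrals.Basic

/-!
# Crux `BoundaryTransferWeak` (stmt-AtomisticToContinuum-0827), line `Sketch`
# (idea `coupled-bath-relocation`): stub `stub_freeOneBodyApprox` — one-dimensional integrals

Integral bookkeeping for the free one-body approximants of the sine mode
(`BECInsertionCorrectorBoundaryTransferWeakFreeOneBodyApprox.lean`), for the cut-off sine `g_τ`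
of `…FreeOneBodyApproxCutoff.lean`: the interval integrals `A = ∫₀ᴸ g²`, `B = ∫₀ᴸ g'²`,
`D = ∫₀ᴸ (g - sin)²` with `L/2 - τ + (L/π) sin(πτ/L) cos(πτ/L) ≤ A ≤ L/2`,
`B ≤ (π/L)² L/2 + 2τ ((π/L)(1+2C))²`, `D ≤ 2τ`; the normalised profile `g̃ = g/√A`
(`∫ g̃² = 1`, `∫ g̃'² = B/A`, `∫₀ᴸ (g̃ - √(2/L) sin)² ≤ 2D/A + 2(1/√A - √(2/L))² L/2`); the passage
from interval integrals to Lebesgue integrals over `ℝ`; and Tonelli for product functions on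
`ℝ³ = EuclideanSpace ℝ (Fin 3)`. All [folklore].
-/

noncomputable section

namespace Summit.AtomisticToContinuum.BoseEinsteinCondensation.CoupledBaths

open Literature.MathematicalPhysics.QuantumManyBody.BoseGas MeasureTheory Filter Topology Set
open scoped ENNReal NNReal

namespace FreeOneBodyApprox

variable {L τ : ℝ}

/-! ### One-dimensional integrals -/

/-- `∫₀ᴸ cos²(πt/L) dt = L/2`. [folklore] -/
theorem integral_cos_sq_eq (hL : 0 < L) :
    ∫ t in (0 : ℝ)..L, Real.cos (Real.pi * t / L) ^ 2 = L / 2 := by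
  have hc : Real.pi / L ≠ 0 := (div_pos Real.pi_pos hL).ne'
  have h1 : (fun t => Real.cos (Real.pi * t / L) ^ 2) =
      fun t => (fun u => Real.cos u ^ 2) (Real.pi / L * t) := by
    funext t; simp only; congr 2; ring
  rw [h1, intervalIntegral.integral_comp_mul_left (fun u => Real.cos u ^ 2) hc, integral_cos_sq,
    mul_zero, div_mul_cancel₀ _ hL.ne', Real.sin_zero, Real.sin_pi, smul_eq_mul]
  field_simp
  ring

/-- `∫_τ^{L-τ} sin²(πt/L) dt = L/2 - τ + (L/π) sin(πτ/L) cos(πτ/L)`. [folklore] -/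
theorem integral_sin_sq_mid (hL : 0 < L) (τ : ℝ) :
    ∫ t in τ..(L - τ), Real.sin (Real.pi * t / L) ^ 2 =
      L / 2 - τ + L / Real.pi * Real.sin (Real.pi / L * τ) * Real.cos (Real.pi / L * τ) := by
  have hc : Real.pi / L ≠ 0 := (div_pos Real.pi_pos hL).ne'
  have h1 : (fun t => Real.sin (Real.pi * t / L) ^ 2) =
      fun t => (fun u => Real.sin u ^ 2) (Real.pi / L * t) := by
    funext t; simp only; congr 2; ring
  have hb : Real.pi / L * (L - τ) = Real.pi - Real.pi / L * τ := by field_simp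
  rw [h1, intervalIntegral.integral_comp_mul_left (fun u => Real.sin u ^ 2) hc, integral_sin_sq, hb,
    Real.sin_pi_sub, Real.cos_pi_sub, smul_eq_mul]
  field_simp
  ring

/-- `∫₀ᴸ sin²(πt/L) dt = L/2` (the case `τ = 0` of `integral_sin_sq_mid`). [folklore] -/
theorem integral_sin_sq_zero_len (hL : 0 < L) :
    ∫ t in (0 : ℝ)..(L - 0), Real.sin (Real.pi * t / L) ^ 2 = L / 2 := by
  rw [integral_sin_sq_mid hL 0]; simp

/-- Splitting an interval integral of a continuous function at two points. [folklore] -/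
theorem integral_split3 {f : ℝ → ℝ} (hf : Continuous f) (a b c d : ℝ) :
    ∫ t in a..d, f t = (∫ t in a..b, f t) + (∫ t in b..c, f t) + ∫ t in c..d, f t := by
  rw [intervalIntegral.integral_add_adjacent_intervals (hf.intervalIntegrable _ _)
      (hf.intervalIntegrable _ _),
    intervalIntegral.integral_add_adjacent_intervals (hf.intervalIntegrable _ _)
      (hf.intervalIntegrable _ _)]

/-- An interval integral of a function bounded by a constant on the interval. [folklore] -/
theorem integral_le_of_le_const {f : ℝ → ℝ} (hf : Continuous f) {a b c : ℝ} (hab : a ≤ b)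
    (h : ∀ t ∈ Icc a b, f t ≤ c) : ∫ t in a..b, f t ≤ (b - a) * c := by
  have := intervalIntegral.integral_mono_on (μ := volume) hab (hf.intervalIntegrable _ _)
    (continuous_const.intervalIntegrable _ _) h
  rwa [intervalIntegral.integral_const, smul_eq_mul] at this

/-- The mass `A = ∫₀ᴸ g²`. [folklore] -/
def massA (L τ : ℝ) : ℝ := ∫ t in (0 : ℝ)..L, gcut L τ t ^ 2

/-- The kinetic integral `B = ∫₀ᴸ g'²`. [folklore] -/
def kinB (L τ : ℝ) : ℝ := ∫ t in (0 : ℝ)..L, dgcut L τ t ^ 2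

/-- The defect `D = ∫₀ᴸ (g - sin(π·/L))²`. [folklore] -/
def defD (L τ : ℝ) : ℝ := ∫ t in (0 : ℝ)..L, (gcut L τ t - Real.sin (Real.pi * t / L)) ^ 2

/-- `g²` is continuous. [folklore] -/
theorem continuous_gcut_sq (L τ : ℝ) : Continuous fun t => gcut L τ t ^ 2 :=
  (contDiff_gcut L τ (n := 0)).continuous.pow 2

/-- `g'` is continuous. [folklore] -/
theorem continuous_dgcut (L τ : ℝ) : Continuous (dgcut L τ) := by
  have h : dgcut L τ = deriv (gcut L τ) := funext fun t => ((hasDerivAt_gcut L τ t).deriv).symm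
  rw [h]
  exact (contDiff_gcut L τ (n := 1)).continuous_deriv le_rfl

/-- `A ≤ L/2`. [folklore] -/
theorem massA_le (hL : 0 < L) (τ : ℝ) : massA L τ ≤ L / 2 := by
  rw [massA, ← integral_sin_sq_zero_len hL, sub_zero]
  exact intervalIntegral.integral_mono_on hL.le ((continuous_gcut_sq L τ).intervalIntegrable _ _)
    ((by fun_prop : Continuous fun t => Real.sin (Real.pi * t / L) ^ 2).intervalIntegrable _ _)
    fun t _ => gcut_sq_le L τ t

/-- `L/2 - τ + (L/π) sin(πτ/L) cos(πτ/L) ≤ A` for `0 < τ ≤ L/2`. [folklore] -/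
theorem le_massA (hL : 0 < L) (hτ : 0 < τ) (hτ2 : τ ≤ L / 2) :
    L / 2 - τ + L / Real.pi * Real.sin (Real.pi / L * τ) * Real.cos (Real.pi / L * τ) ≤
      massA L τ := by
  rw [← integral_sin_sq_mid hL τ]
  have hmid : ∫ t in τ..(L - τ), Real.sin (Real.pi * t / L) ^ 2 =
      ∫ t in τ..(L - τ), gcut L τ t ^ 2 := by
    refine intervalIntegral.integral_congr fun t ht => ?_
    rw [uIcc_of_le (by linarith)] at ht
    simp only [gcut_eq_sin hτ ht.1 ht.2]
  rw [hmid, massA]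
  exact intervalIntegral.integral_mono_interval hτ.le (by linarith) (by linarith)
    (Eventually.of_forall fun t => sq_nonneg _) ((continuous_gcut_sq L τ).intervalIntegrable _ _)

/-- `B ≤ (π/L)²·L/2 + 2τ·((π/L)(1+2C))²` for `0 < τ ≤ L/2`. [folklore] -/
theorem kinB_le (hL : 0 < L) (hτ : 0 < τ) (hτ2 : τ ≤ L / 2) {C : ℝ}
    (hC : ∀ y, |deriv Real.smoothTransition y| ≤ C) :
    kinB L τ ≤ (Real.pi / L) ^ 2 * (L / 2) + 2 * τ * (Real.pi / L * (1 + 2 * C)) ^ 2 := by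
  have hcont : Continuous fun t => dgcut L τ t ^ 2 := (continuous_dgcut L τ).pow 2
  have hK : ∀ t, (0 ≤ t ∧ t ≤ τ) ∨ (L - τ ≤ t ∧ t ≤ L) →
      dgcut L τ t ^ 2 ≤ (Real.pi / L * (1 + 2 * C)) ^ 2 := by
    intro t ht
    have h := abs_dgcut_le_ends hL hτ (by linarith) hC ht
    have h0 : 0 ≤ Real.pi / L * (1 + 2 * C) := (abs_nonneg _).trans h
    exact sq_le_sq.2 (by rwa [abs_of_nonneg h0])
  rw [kinB, integral_split3 hcont 0 τ (L - τ) L]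
  have h1 : ∫ t in (0 : ℝ)..τ, dgcut L τ t ^ 2 ≤ (τ - 0) * (Real.pi / L * (1 + 2 * C)) ^ 2 :=
    integral_le_of_le_const hcont hτ.le fun t ht => hK t (Or.inl ht)
  have h3 : ∫ t in (L - τ)..L, dgcut L τ t ^ 2 ≤ (L - (L - τ)) * (Real.pi / L * (1 + 2 * C)) ^ 2 :=
    integral_le_of_le_const hcont (by linarith) fun t ht => hK t (Or.inr ht)
  have h2 : ∫ t in τ..(L - τ), dgcut L τ t ^ 2 ≤ (Real.pi / L) ^ 2 * (L / 2) := by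
    have hmid : ∫ t in τ..(L - τ), dgcut L τ t ^ 2 =
        ∫ t in τ..(L - τ), (Real.pi / L) ^ 2 * Real.cos (Real.pi * t / L) ^ 2 := by
      refine intervalIntegral.integral_congr fun t ht => ?_
      rw [uIcc_of_le (by linarith)] at ht
      simp only [dgcut_eq_cos hτ ht.1 ht.2, mul_pow]
    rw [hmid, ← integral_cos_sq_eq hL, ← intervalIntegral.integral_const_mul]
    exact intervalIntegral.integral_mono_interval hτ.le (by linarith) (by linarith)
      (Eventually.of_forall fun t => by positivity)
      ((by fun_prop : Continuous fun t =>
        (Real.pi / L) ^ 2 * Real.cos (Real.pi * t / L) ^ 2).intervalIntegrable _ _)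
  calc _ ≤ (τ - 0) * (Real.pi / L * (1 + 2 * C)) ^ 2 + (Real.pi / L) ^ 2 * (L / 2) +
        (L - (L - τ)) * (Real.pi / L * (1 + 2 * C)) ^ 2 := add_le_add (add_le_add h1 h2) h3
    _ = _ := by ring

/-- `D ≤ 2τ` for `0 < τ ≤ L/2`. [folklore] -/
theorem defD_le (hτ : 0 < τ) (hτ2 : τ ≤ L / 2) : defD L τ ≤ 2 * τ := by
  have hcont : Continuous fun t => (gcut L τ t - Real.sin (Real.pi * t / L)) ^ 2 := by
    have := (contDiff_gcut L τ (n := 0)).continuous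
    fun_prop
  rw [defD, integral_split3 hcont 0 τ (L - τ) L]
  have h1 : ∫ t in (0 : ℝ)..τ, (gcut L τ t - Real.sin (Real.pi * t / L)) ^ 2 ≤ (τ - 0) * 1 :=
    integral_le_of_le_const hcont hτ.le fun t _ => gcut_sub_sin_sq_le_one L τ t
  have h3 : ∫ t in (L - τ)..L, (gcut L τ t - Real.sin (Real.pi * t / L)) ^ 2 ≤ (L - (L - τ)) * 1 :=
    integral_le_of_le_const hcont (by linarith) fun t _ => gcut_sub_sin_sq_le_one L τ t
  have h2 : ∫ t in τ..(L - τ), (gcut L τ t - Real.sin (Real.pi * t / L)) ^ 2 = 0 := by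
    rw [← intervalIntegral.integral_zero (a := τ) (b := L - τ) (μ := volume) (E := ℝ)]
    refine intervalIntegral.integral_congr fun t ht => ?_
    rw [uIcc_of_le (by linarith)] at ht
    simp only [gcut_eq_sin hτ ht.1 ht.2, sub_self]
    norm_num
  rw [h2]
  linarith

/-! ### The normalised profile -/

/-- The normalised profile `g̃ = g / √A`. [folklore] -/
def gn (L τ t : ℝ) : ℝ := gcut L τ t / Real.sqrt (massA L τ)

/-- Its derivative `g̃' = g' / √A`. [folklore] -/
def dgn (L τ t : ℝ) : ℝ := dgcut L τ t / Real.sqrt (massA L τ)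

/-- The normalised sine `s̃(t) = √(2/L) sin(πt/L)`. [folklore] -/
def sn (L t : ℝ) : ℝ := Real.sqrt (2 / L) * Real.sin (Real.pi * t / L)

/-- `g̃` is smooth. [folklore] -/
theorem contDiff_gn (L τ : ℝ) {n : ℕ∞} : ContDiff ℝ n (gn L τ) :=
  (contDiff_gcut L τ).div_const _

/-- `g̃' = dgn`. [folklore] -/
theorem hasDerivAt_gn (L τ t : ℝ) : HasDerivAt (gn L τ) (dgn L τ t) t :=
  (hasDerivAt_gcut L τ t).div_const _

/-- `g̃'` is continuous. [folklore] -/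
theorem continuous_dgn (L τ : ℝ) : Continuous (dgn L τ) :=
  (continuous_dgcut L τ).div_const _

/-- `s̃` is continuous. [folklore] -/
theorem continuous_sn (L : ℝ) : Continuous (sn L) := by
  unfold sn; fun_prop

/-- `g̃ = 0` off `(0, L)`. [folklore] -/
theorem gn_eq_zero (hτ : 0 < τ) {t : ℝ} (ht : t ∉ Ioo 0 L) : gn L τ t = 0 := by
  simp [gn, gcut_eq_zero hτ ht]

/-- `g̃' = 0` off `(0, L)`. [folklore] -/
theorem dgn_eq_zero (hτ : 0 < τ) {t : ℝ} (ht : t ∉ Ioo 0 L) : dgn L τ t = 0 := by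
  simp [dgn, dgcut_eq_zero hτ ht]

/-- `∫₀ᴸ g̃² = 1`. [folklore] -/
theorem integral_gn_sq (hA : 0 < massA L τ) : ∫ t in (0 : ℝ)..L, gn L τ t ^ 2 = 1 := by
  simp only [gn, div_pow, Real.sq_sqrt hA.le, intervalIntegral.integral_div]
  rw [← massA, div_self hA.ne']

/-- `∫₀ᴸ g̃'² = B / A`. [folklore] -/
theorem integral_dgn_sq (hA : 0 < massA L τ) :
    ∫ t in (0 : ℝ)..L, dgn L τ t ^ 2 = kinB L τ / massA L τ := by
  simp only [dgn, div_pow, Real.sq_sqrt hA.le, intervalIntegral.integral_div]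
  rfl

/-- `∫₀ᴸ s̃² = 1`. [folklore] -/
theorem integral_sn_sq (hL : 0 < L) : ∫ t in (0 : ℝ)..L, sn L t ^ 2 = 1 := by
  have h := integral_sin_sq_zero_len hL
  rw [sub_zero] at h
  simp only [sn, mul_pow, Real.sq_sqrt (by positivity : (0 : ℝ) ≤ 2 / L),
    intervalIntegral.integral_const_mul, h]
  field_simp

/-- `∫₀ᴸ (g̃ - s̃)² ≤ 2D/A + 2 (1/√A - √(2/L))² (L/2)`. [folklore] -/
theorem integral_gn_sub_sn_sq_le (hL : 0 < L) (hA : 0 < massA L τ) :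
    ∫ t in (0 : ℝ)..L, (gn L τ t - sn L t) ^ 2 ≤
      2 / massA L τ * defD L τ + 2 * ((Real.sqrt (massA L τ))⁻¹ - Real.sqrt (2 / L)) ^ 2 * (L / 2) := by
  set c : ℝ := (Real.sqrt (massA L τ))⁻¹ - Real.sqrt (2 / L) with hc
  have hsA : 0 < Real.sqrt (massA L τ) := Real.sqrt_pos.2 hA
  have hpt : ∀ t, (gn L τ t - sn L t) ^ 2 ≤
      2 / massA L τ * (gcut L τ t - Real.sin (Real.pi * t / L)) ^ 2 +
        2 * c ^ 2 * Real.sin (Real.pi * t / L) ^ 2 := by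
    intro t
    have he : gn L τ t - sn L t =
        (gcut L τ t - Real.sin (Real.pi * t / L)) / Real.sqrt (massA L τ) +
          c * Real.sin (Real.pi * t / L) := by
      simp only [gn, sn, hc]; field_simp; ring
    rw [he]
    have h2 : ∀ x y : ℝ, (x + y) ^ 2 ≤ 2 * x ^ 2 + 2 * y ^ 2 := fun x y => by
      nlinarith [sq_nonneg (x - y)]
    refine (h2 _ _).trans (le_of_eq ?_)
    rw [div_pow, Real.sq_sqrt hA.le]
    ring
  have hsin : ∫ t in (0 : ℝ)..L, Real.sin (Real.pi * t / L) ^ 2 = L / 2 := by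
    have h := integral_sin_sq_zero_len hL
    rwa [sub_zero] at h
  have hg : Continuous fun t => (gcut L τ t - Real.sin (Real.pi * t / L)) ^ 2 := by
    have := (contDiff_gcut L τ (n := 0)).continuous; fun_prop
  have hs : Continuous fun t => Real.sin (Real.pi * t / L) ^ 2 := by fun_prop
  calc ∫ t in (0 : ℝ)..L, (gn L τ t - sn L t) ^ 2
      ≤ ∫ t in (0 : ℝ)..L, (2 / massA L τ * (gcut L τ t - Real.sin (Real.pi * t / L)) ^ 2 +
          2 * c ^ 2 * Real.sin (Real.pi * t / L) ^ 2) :=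
        intervalIntegral.integral_mono_on hL.le
          ((by have := (contDiff_gn L τ (n := 0)).continuous; have := continuous_sn L; fun_prop :
            Continuous fun t => (gn L τ t - sn L t) ^ 2).intervalIntegrable _ _)
          ((by fun_prop : Continuous fun t =>
            2 / massA L τ * (gcut L τ t - Real.sin (Real.pi * t / L)) ^ 2 +
              2 * c ^ 2 * Real.sin (Real.pi * t / L) ^ 2).intervalIntegrable _ _)
          fun t _ => hpt t
    _ = 2 / massA L τ * defD L τ + 2 * c ^ 2 * (L / 2) := by
        rw [intervalIntegral.integral_add ((hg.const_mul _).intervalIntegrable _ _)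
            ((hs.const_mul _).intervalIntegrable _ _),
          intervalIntegral.integral_const_mul, intervalIntegral.integral_const_mul, hsin, defD]

/-! ### From interval integrals to Lebesgue integrals over `ℝ` -/

/-- For a continuous nonnegative `f`: `∫⁻ 1_{(0,L)} f = ofReal (∫₀ᴸ f)`. [folklore] -/
theorem lintegral_indicator_ofReal (hL : 0 ≤ L) {f : ℝ → ℝ} (hf : Continuous f)
    (h0 : ∀ t, 0 ≤ f t) :
    ∫⁻ t, (Ioo 0 L).indicator (fun t => ENNReal.ofReal (f t)) t =
      ENNReal.ofReal (∫ t in (0 : ℝ)..L, f t) := by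
  rw [lintegral_indicator measurableSet_Ioo, intervalIntegral.integral_of_le hL,
    integral_Ioc_eq_integral_Ioo, ofReal_integral_eq_lintegral_ofReal]
  · exact hf.integrableOn_Icc.mono_set Ioo_subset_Icc_self
  · exact Eventually.of_forall fun t => h0 t

/-- `∫⁻ g̃² = 1` (over `ℝ`). [folklore] -/
theorem lintegral_gn_sq (hL : 0 ≤ L) (hτ : 0 < τ) (hA : 0 < massA L τ) :
    ∫⁻ t, ENNReal.ofReal (gn L τ t ^ 2) = 1 := by
  have h : (fun t => ENNReal.ofReal (gn L τ t ^ 2)) =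
      (Ioo 0 L).indicator fun t => ENNReal.ofReal (gn L τ t ^ 2) := by
    funext t
    by_cases ht : t ∈ Ioo 0 L
    · rw [indicator_of_mem ht]
    · rw [indicator_of_notMem ht, gn_eq_zero hτ ht]; simp
  rw [h, lintegral_indicator_ofReal (f := fun t => gn L τ t ^ 2) hL
    ((contDiff_gn L τ (n := 0)).continuous.pow 2) (fun t => sq_nonneg _), integral_gn_sq hA,
    ENNReal.ofReal_one]

/-- `∫⁻ g̃'² = ofReal (B/A)` (over `ℝ`). [folklore] -/
theorem lintegral_dgn_sq (hL : 0 ≤ L) (hτ : 0 < τ) (hA : 0 < massA L τ) :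
    ∫⁻ t, ENNReal.ofReal (dgn L τ t ^ 2) = ENNReal.ofReal (kinB L τ / massA L τ) := by
  have h : (fun t => ENNReal.ofReal (dgn L τ t ^ 2)) =
      (Ioo 0 L).indicator fun t => ENNReal.ofReal (dgn L τ t ^ 2) := by
    funext t
    by_cases ht : t ∈ Ioo 0 L
    · rw [indicator_of_mem ht]
    · rw [indicator_of_notMem ht, dgn_eq_zero hτ ht]; simp
  rw [h, lintegral_indicator_ofReal (f := fun t => dgn L τ t ^ 2) hL ((continuous_dgn L τ).pow 2)
    (fun t => sq_nonneg _), integral_dgn_sq hA]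

/-- `∫⁻ 1_{(0,L)} s̃² = 1`. [folklore] -/
theorem lintegral_indicator_sn_sq (hL : 0 < L) :
    ∫⁻ t, (Ioo 0 L).indicator (fun t => ENNReal.ofReal (sn L t ^ 2)) t = 1 := by
  rw [lintegral_indicator_ofReal (f := fun t => sn L t ^ 2) hL.le ((continuous_sn L).pow 2)
    (fun t => sq_nonneg _), integral_sn_sq hL, ENNReal.ofReal_one]

/-- `∫⁻ 1_{(0,L)} (g̃ - s̃)² ≤ ofReal (2D/A + 2 (1/√A - √(2/L))² (L/2))`. [folklore] -/
theorem lintegral_indicator_gn_sub_sn_sq_le (hL : 0 < L) (hA : 0 < massA L τ) :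
    ∫⁻ t, (Ioo 0 L).indicator (fun t => ENNReal.ofReal ((gn L τ t - sn L t) ^ 2)) t ≤
      ENNReal.ofReal (2 / massA L τ * defD L τ +
        2 * ((Real.sqrt (massA L τ))⁻¹ - Real.sqrt (2 / L)) ^ 2 * (L / 2)) := by
  rw [lintegral_indicator_ofReal hL.le (by
    have := (contDiff_gn L τ (n := 0)).continuous; have := continuous_sn L; fun_prop)
    (fun t => sq_nonneg _)]
  exact ENNReal.ofReal_le_ofReal (integral_gn_sub_sn_sq_le hL hA)

end FreeOneBodyApprox

/-! ### Tonelli for product functions on `ℝ³` -/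

/-- **Tonelli for product functions on `ℝ³`** (registered anchor of this helper file):
`∫ ∏ₖ Fₖ(x_k) dx = ∏ₖ ∫ Fₖ` for measurable `Fₖ : ℝ → [0, ∞]`, through the measure-preserving
identification `EuclideanSpace ℝ (Fin 3) ≃ (Fin 3 → ℝ)`. [folklore] -/
theorem lintegral_prod_space :
    ∀ (F : Fin 3 → ℝ → ℝ≥0∞), (∀ k, Measurable (F k)) →
      ∫⁻ x : Space, ∏ k, F k (x k) = ∏ k, ∫⁻ t, F k t := by
  intro F hF
  have hm : Measurable fun y : Fin 3 → ℝ => ∏ k, F k (y k) :=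
    Finset.measurable_prod _ fun k _ => (hF k).comp (measurable_pi_apply k)
  have h := (PiLp.volume_preserving_ofLp (Fin 3)).lintegral_comp hm
  rw [h, volume_pi]
  exact Literature.Probability.Distributions.lintegral_fin_nat_prod_eq_prod _ _ hF

/-- Three-factor version of `lintegral_prod_space`. [folklore] -/
theorem lintegral_mul_three_space (F₀ F₁ F₂ : ℝ → ℝ≥0∞) (h₀ : Measurable F₀) (h₁ : Measurable F₁)
    (h₂ : Measurable F₂) :
    ∫⁻ x : Space, F₀ (x 0) * F₁ (x 1) * F₂ (x 2) = (∫⁻ t, F₀ t) * (∫⁻ t, F₁ t) * ∫⁻ t, F₂ t := by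
  have h := lintegral_prod_space ![F₀, F₁, F₂] (fun k => by fin_cases k <;> assumption)
  simpa [Fin.prod_univ_three] using h

end Summit.AtomisticToContinuum.BoseEinsteinCondensation.CoupledBaths

end
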